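import Mathlib
import HarnessLib
import Literature.Computability.AlgebraicComplexity.TensorSemiring
import Literature.Computability.AlgebraicComplexity.TensorRestrictionRank
import Literature.Computability.AlgebraicComplexity.AsymptoticSpectrumDuality
import Literature.Computability.AlgebraicComplexity.AsymptoticRankMatMul
import Literature.Computability.AlgebraicComplexity.AlmanLi2026SpectrumMatMul
import Summits.MatrixMultiplication.MatrixMultiplication.Theorems.OutsiderSandwichGluingGain

/-!
# Outsider sandwich — the TRACE DEFECT of the coupled block: `C₁` and `⟨2,2,2⟩` differ by one
# scalar–vector product (decomp-mm lens-4, g22, part 1)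

Lens «minimal-counterexample / extremal reduction», generation 22, supporting item
`stmt-MatrixMultiplication-27147` (`Theses.OutsiderSandwich.BlockOneIsMM`, the ω-free leaf
`∀ universal F, F⟨2,2,2⟩ ≤ F(C₁)`; cut of record `LaserTangency ∧ LaserMergeOptimal` UNCHANGED).

By g21 the minimal counterexample to the leaf is ONE universal point `F` with `gain F < θ₁(F)`
(`gain F = log₂ F(C₁) − θ₀ − θ₂ ∈ [0,1]`).  This file identifies EXACTLY what separates the coupled
Coppersmith–Winograd block `C₁ ≅ (A; u, w) ↦ (Au, Aᵀw)` from `⟨2,2,2⟩ ≅ (A; u, w) ↦ (Au, Aw)`: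
the `2 × 2` adjugate identity `A = tr(A)·I − J⁻¹AᵀJ` (`J = [[0,1],[-1,0]]`, `J⁻¹AᵀJ = adj A`) says
that the second slot of `⟨2,2,2⟩` is the second slot of `C₁` read through the signed relabelling
`w ↦ Jw`, output `↦ −J⁻¹(·)`, PLUS the scalar–vector product `(A; w) ↦ tr(A)·w`, which is the
`1 × 2 × 2` matrix multiplication tensor `⟨1,2,1⟩` fed through the trace functional.  Hence, as
explicit restrictions with `0/±1` matrices (no `ω`, no spectral input):

* **`C₁ ⊕ ⟨1,2,1⟩ ≥ ⟨2,2,2⟩`** (`directSum_coupling₁_restrictsTo_matMul`) and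
  **`⟨2,2,2⟩ ⊕ ⟨1,2,1⟩ ≥ C₁`** (`directSum_matMul_restrictsTo_coupling₁`): the TRACE DEFECT of `C₁`
  is one copy of `⟨1,2,1⟩` in each direction;
* at every universal point: **`|F(C₁) − F⟨2,2,2⟩| ≤ F⟨1,2,1⟩ = 2^{θ₁} ≤ 2`**
  (`abs_map_coupling₁_sub_map_matMul_le`), i.e. `2^{τ} − 2^{θ₁} ≤ F(C₁) ≤ 2^{τ} + 2^{θ₁}`
  (`τ = θ₀+θ₁+θ₂`); in gain coordinates **`2^{θ₁}(1 − 2^{−(θ₀+θ₂)}) ≤ 2^{gain F} ≤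
  2^{θ₁}(1 + 2^{−(θ₀+θ₂)})`** — the leaf `θ₁ ≤ gain` and its converse `gain ≤ θ₁` (`BlockBelowMM`)
  each fail at `F` by at most the factor `1 ∓ 2^{−(θ₀+θ₂)} ∈ [½, 1) ∪ (1, 3/2]`
  (`θ₀ + θ₂ ≥ 1` always); the minimal counterexample pays its whole excess
  `F⟨2,2,2⟩ − F(C₁) > 0` out of ONE letter `2^{θ₁}`, so `logRatio F ≤ −log₂(1 − 2^{θ₁−τ})`;
* **`|R̃(C₁) − 2^ω| ≤ 2`** (Strassen duality): the asymptotic rank of the `4 × 4 × 4` block is `2^ω`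
  up to an additive `2`.
(The gain / `logRatio` / `R̃` forms are in the companion module `OutsiderSandwichTraceDefectGain`;
this module stops at the letter sandwich `2^{τ} ∓ 2^{θ₁}`.)

Numerically these floors are dominated at the record window (`τ ≤ 2.373`: `2^τ − 2 < 4 ≤ F(C₁)`);
their content is structural: any refutation of the leaf must be invisible to one `⟨1,2,1⟩`, and
every additive single-copy certificate `⟨2,2,2⟩ ≤ C₁ ⊕ H` is inert unless `F(H) < 2^τ − 4`, i.e.
unless `τ > log₂ 5` (memo NODE-g22).  Part 2 (`OutsiderSandwichTracePencil`) puts `C₁` and `⟨2,2,2⟩`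
on the one-parameter trace pencil `T(c) : (A; u, w) ↦ (Au, (A₀ + c·(tr A/2)·I) w)` as its two
inversion-fixed members `c = ∓1`.

[ChristandlVranaZuiddam2023, §1.1–1.2, Prop. 1.6]; [AlmanLi2026, Prop. 4.1–4.2]; [Blaser2013, Def. 7.2];
[Strassen1988, Thm. 3.8]; [CoppersmithWinograd1990, §7].
-/

noncomputable section

open Literature.Computability.AlgebraicComplexity
open Summit.MatrixMultiplication.MatrixMultiplication.Theorems.OutsiderSandwichCoupling (coupling₁)
open Summit.MatrixMultiplication.MatrixMultiplication.Theorems.OutsiderSandwichBlockNormalForm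
  (pairTensor coupling₁_restrictsTo_pairTensor pairTensor_restrictsTo_coupling₁
    map_coupling₁_eq_map_pairTensor)
open Summit.MatrixMultiplication.MatrixMultiplication.Theorems.OutsiderSandwichExchangeSpectral
  (logRatio four_le_map_coupling₁ map_matMul_eq_rpow map_matMul_le_rpow_omega)
open Summit.MatrixMultiplication.MatrixMultiplication.Theorems.OutsiderSandwichGluingGain

namespace Summit.MatrixMultiplication.MatrixMultiplication.Theorems.OutsiderSandwichTraceDefect

/-! ## 0. One restriction tool: signed relabelling on all three legs -/

section Tools

variable {K : Type} [CommSemiring K] {ι κ μ ι' κ' μ' : Type} [Fintype ι] [Fintype κ] [Fintype μ]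
  [DecidableEq ι] [DecidableEq κ] [DecidableEq μ]

/-- **Weighted relabelling along index maps, weights on all three legs, is a restriction**:
`t ≥ (φ(a) ψ(b) χ(c) · t (f a) (g b) (h c))_{a,b,c}` (matrices `diag(φ) f^*`, `diag(ψ) g^*`,
`diag(χ) h^*`; the tree's `tensorRestrictsTo_precomp_mul` is the case `χ = 1`).
[cite: Blaser2013, Def. 7.2] -/
theorem tensorRestrictsTo_precomp_mul₃ (t : ι → κ → μ → K) (f : ι' → ι) (g : κ' → κ) (h : μ' → μ)
    (φ : ι' → K) (ψ : κ' → K) (χ : μ' → K) :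
    TensorRestrictsTo t (fun a b c => φ a * ψ b * χ c * t (f a) (g b) (h c)) := by
  refine ⟨fun a' a => if f a' = a then φ a' else 0, fun b' b => if g b' = b then ψ b' else 0,
    fun c' c => if h c' = c then χ c' else 0, fun a' b' c' => ?_⟩
  rw [Finset.sum_eq_single (f a') (fun a _ ha => by simp [Ne.symm ha]) (by simp),
    Finset.sum_eq_single (g b') (fun b _ hb => by simp [Ne.symm hb]) (by simp),
    Finset.sum_eq_single (h c') (fun c _ hc => by simp [Ne.symm hc]) (by simp)]
  simp

end Tools

/-! ## 1. The cast: the plain second slot, the trace helper, the two signed twists -/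

/-- The PLAIN second slot `(A; w) ↦ Aw` (input `y`-block `1`, output `z`-block `0`): entry `1` at
`((r,c), (1,c), (0,r))` (the term `A_{rc} w_c` of `(Aw)_r`).  Replacing `wHalf` (`w ↦ Aᵀw`) by it turns
`pairTensor` into matrix multiplication. [cite: Blaser2013, §5 (the tensor ⟨k,m,n⟩)] -/
def wPlain (n : ℕ) : Fin n × Fin n → Fin 2 × Fin n → Fin 2 × Fin n → ℂ :=
  fun a y z => if y.1 = 1 ∧ z.1 = 0 ∧ y.2 = a.2 ∧ z.2 = a.1 then 1 else 0

/-- **`mmPair n := uHalf n + wPlain n ≅ (A; u, w) ↦ (Au, Aw)`** — two matrix–vector products by the SAME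
matrix; for `n = 2` this is `⟨2,2,2⟩` relabelled (`mmPair_two_restrictsTo_matMul`,
`matMul_restrictsTo_mmPair_two`). [cite: Blaser2013, §5 (the tensor ⟨k,m,n⟩)] -/
def mmPair (n : ℕ) : Fin n × Fin n → Fin 2 × Fin n → Fin 2 × Fin n → ℂ :=
  uHalf n + wPlain n

/-- The TRACE HELPER `(A; w) ↦ tr(A)·w` on the `2 × 2` format (input `y`-block `1`, output `z`-block
`0`): entry `1` at `((r,r), (1,c), (0,c))`; it is `⟨1,2,1⟩` fed through the trace functional
(`matMul121_restrictsTo_traceHelper`, `traceHelper_restrictsTo_matMul121`). [cite: Blaser2013, Def. 7.2] -/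
def traceHelper : Fin 2 × Fin 2 → Fin 2 × Fin 2 → Fin 2 × Fin 2 → ℂ :=
  fun a y z => if y.1 = 1 ∧ z.1 = 0 ∧ a.1 = a.2 ∧ y.2 = z.2 then 1 else 0

/-- The sign `(−1)^i` on `Fin 2`. [folklore] -/
def sgn (i : Fin 2) : ℂ := if i = 0 then 1 else -1

/-- The index flip `0 ↔ 1` on `Fin 2` (the permutation part of `J = [[0,1],[-1,0]]`). [folklore] -/
def flip (i : Fin 2) : Fin 2 := if i = 0 then 1 else 0

/-- The ADJUGATE TWIST of the transposed slot: `(A; w) ↦ adj(A)·w = J⁻¹AᵀJ·w` (`y`-block `1` →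
`z`-block `0`), `adj(A)_{lj} = (−1)^{l+j} A_{σj,σl}`: entry `(−1)^{j+l}` at `((σj, σl), (1,j), (0,l))`.
It is the `wHalf` slot of `pairTensor 2` read through `w ↦ Jw`, output `↦ J⁻¹(·)`.
[cite: CoppersmithWinograd1990, §7] -/
def adjTwist : Fin 2 × Fin 2 → Fin 2 × Fin 2 → Fin 2 × Fin 2 → ℂ :=
  fun a y z => if y.1 = 1 ∧ z.1 = 0 ∧ a.1 = flip y.2 ∧ a.2 = flip z.2 then sgn y.2 * sgn z.2 else 0

/-- The ADJUGATE TWIST of the plain slot: `(A; w) ↦ adj(A)ᵀ·w = J⁻¹AJ·w`, entry `(−1)^{j+l}` at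
`((σl, σj), (1,j), (0,l))`; it is the `wPlain` slot of `mmPair 2` read through `w ↦ Jw`, output
`↦ J⁻¹(·)`. [cite: CoppersmithWinograd1990, §7] -/
def adjTwist' : Fin 2 × Fin 2 → Fin 2 × Fin 2 → Fin 2 × Fin 2 → ℂ :=
  fun a y z => if y.1 = 1 ∧ z.1 = 0 ∧ a.1 = flip z.2 ∧ a.2 = flip y.2 then sgn y.2 * sgn z.2 else 0

/-! ## 2. The `2 × 2` adjugate identity as two tensor identities -/

/-- **`A = tr(A)·I − adj(A)`**, slot form: `wPlain 2 = traceHelper − adjTwist`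
(`(Aw)_l = tr(A) w_l − (adj(A) w)_l`). [cite: CoppersmithWinograd1990, §7] -/
theorem wPlain_two_eq : wPlain 2 = traceHelper - adjTwist := by
  funext a y z
  obtain ⟨a₁, a₂⟩ := a
  obtain ⟨y₁, y₂⟩ := y
  obtain ⟨z₁, z₂⟩ := z
  simp only [wPlain, traceHelper, adjTwist, sgn, flip, Pi.sub_apply]
  fin_cases a₁ <;> fin_cases a₂ <;> fin_cases y₁ <;> fin_cases y₂ <;> fin_cases z₁ <;> fin_cases z₂ <;>
    simp

/-- **`Aᵀ = tr(A)·I − adj(A)ᵀ`**, slot form: `wHalf 2 = traceHelper − adjTwist'`.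
[cite: CoppersmithWinograd1990, §7] -/
theorem wHalf_two_eq : wHalf 2 = traceHelper - adjTwist' := by
  funext a y z
  obtain ⟨a₁, a₂⟩ := a
  obtain ⟨y₁, y₂⟩ := y
  obtain ⟨z₁, z₂⟩ := z
  simp only [wHalf, traceHelper, adjTwist', sgn, flip, Pi.sub_apply]
  fin_cases a₁ <;> fin_cases a₂ <;> fin_cases y₁ <;> fin_cases y₂ <;> fin_cases z₁ <;> fin_cases z₂ <;>
    simp

/-- `⟨2,2,2⟩`-pair `= (C₁-pair with the adjugate twist removed) + trace helper`:
`mmPair 2 = (uHalf 2 − adjTwist) + traceHelper`. [cite: CoppersmithWinograd1990, §7] -/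
theorem mmPair_two_eq : mmPair 2 = (uHalf 2 - adjTwist) + traceHelper := by
  rw [mmPair, wPlain_two_eq]; abel

/-- `C₁`-pair `= (⟨2,2,2⟩-pair with the adjugate twist removed) + trace helper`:
`pairTensor 2 = (uHalf 2 − adjTwist') + traceHelper`. [cite: CoppersmithWinograd1990, §7] -/
theorem pairTensor_two_eq : pairTensor 2 = (uHalf 2 - adjTwist') + traceHelper := by
  rw [pairTensor_eq_add, wHalf_two_eq]; abel

/-! ## 3. The five elementary restrictions -/

/-- The signed relabelling `y ↦ (y.1, σ y.2)` on the `y`-block `1` (identity on block `0`). [folklore] -/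
def twistY (y : Fin 2 × Fin 2) : Fin 2 × Fin 2 := if y.1 = 1 then (y.1, flip y.2) else y

/-- The signed relabelling `z ↦ (z.1, σ z.2)` on the `z`-block `0` (identity on block `1`). [folklore] -/
def twistZ (z : Fin 2 × Fin 2) : Fin 2 × Fin 2 := if z.1 = 0 then (z.1, flip z.2) else z

/-- Weight `(−1)^{j}` on the `y`-block `1`, `1` on block `0`. [folklore] -/
def weightY (y : Fin 2 × Fin 2) : ℂ := if y.1 = 1 then sgn y.2 else 1

/-- Weight `−(−1)^{l}` on the `z`-block `0`, `1` on block `1`. [folklore] -/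
def weightZ (z : Fin 2 × Fin 2) : ℂ := if z.1 = 0 then -sgn z.2 else 1

/-- **`pairTensor 2 ≥ uHalf 2 − adjTwist`**: keep the `u ↦ Au` slot, read the `w ↦ Aᵀw` slot through
`w ↦ Jw`, output `↦ −J⁻¹(·)` (a signed relabelling). [cite: Blaser2013, Def. 7.2] -/
theorem pairTensor_restrictsTo_uHalf_sub_adjTwist :
    TensorRestrictsTo (pairTensor 2) (uHalf 2 - adjTwist) := by
  have e : uHalf 2 - adjTwist =
      fun a y z => (1 : ℂ) * weightY y * weightZ z * pairTensor 2 a (twistY y) (twistZ z) := by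
    funext a y z
    obtain ⟨a₁, a₂⟩ := a
    obtain ⟨y₁, y₂⟩ := y
    obtain ⟨z₁, z₂⟩ := z
    simp only [uHalf, adjTwist, pairTensor, weightY, weightZ, twistY, twistZ, sgn, flip, Pi.sub_apply]
    fin_cases a₁ <;> fin_cases a₂ <;> fin_cases y₁ <;> fin_cases y₂ <;> fin_cases z₁ <;>
      fin_cases z₂ <;> simp
  rw [e]
  exact tensorRestrictsTo_precomp_mul₃ _ _ _ _ _ _ _

/-- **`mmPair 2 ≥ uHalf 2 − adjTwist'`** (same signed relabelling on the plain slot).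
[cite: Blaser2013, Def. 7.2] -/
theorem mmPair_restrictsTo_uHalf_sub_adjTwist' :
    TensorRestrictsTo (mmPair 2) (uHalf 2 - adjTwist') := by
  have e : uHalf 2 - adjTwist' =
      fun a y z => (1 : ℂ) * weightY y * weightZ z * mmPair 2 a (twistY y) (twistZ z) := by
    funext a y z
    obtain ⟨a₁, a₂⟩ := a
    obtain ⟨y₁, y₂⟩ := y
    obtain ⟨z₁, z₂⟩ := z
    simp only [uHalf, adjTwist', mmPair, wPlain, weightY, weightZ, twistY, twistZ, sgn, flip,
      Pi.sub_apply, Pi.add_apply]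
    fin_cases a₁ <;> fin_cases a₂ <;> fin_cases y₁ <;> fin_cases y₂ <;> fin_cases z₁ <;>
      fin_cases z₂ <;> simp
  rw [e]
  exact tensorRestrictsTo_precomp_mul₃ _ _ _ _ _ _ _

/-- **`⟨1,2,1⟩ ≥ traceHelper`**: feed the one-dimensional first leg of `⟨1,2,1⟩` with the trace
(`0/1` matrices: the first-leg matrix is the indicator of the diagonal `{(0,0),(1,1)}`).
[cite: Blaser2013, Def. 7.2] -/
theorem matMul121_restrictsTo_traceHelper :
    TensorRestrictsTo (matMulTensor ℂ 1 2 1) traceHelper := by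
  have e : traceHelper = fun a y z => if a.1 = a.2 ∧ y.1 = 1 ∧ z.1 = 0 then
      matMulTensor ℂ 1 2 1 ((0 : Fin 1), (0 : Fin 1)) ((0 : Fin 1), y.2) (z.2, (0 : Fin 1)) else 0 := by
    funext a y z
    simp only [traceHelper, matMulTensor, true_and, and_true]
    by_cases h1 : y.1 = 1 <;> by_cases h2 : z.1 = 0 <;> by_cases h3 : a.1 = a.2 <;> simp [h1, h2, h3]
  rw [e]
  exact tensorRestrictsTo_maskedPrecomp _ _ _ _ _ _ _

/-- **`traceHelper ≥ ⟨1,2,1⟩`** (read the helper at the matrix index `(0,0)`). [cite: Blaser2013, Def. 7.2] -/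
theorem traceHelper_restrictsTo_matMul121 :
    TensorRestrictsTo traceHelper (matMulTensor ℂ 1 2 1) := by
  have e : matMulTensor ℂ 1 2 1 =
      fun a b c => traceHelper ((0 : Fin 2), (0 : Fin 2)) ((1 : Fin 2), b.2) ((0 : Fin 2), c.1) := by
    funext a b c
    obtain ⟨a₁, a₂⟩ := a
    obtain ⟨b₁, b₂⟩ := b
    obtain ⟨c₁, c₂⟩ := c
    have h₁ : b₁ = a₁ := Subsingleton.elim _ _
    have h₂ : c₂ = a₂ := Subsingleton.elim _ _
    subst h₁ h₂
    simp [traceHelper, matMulTensor]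
  rw [e]
  exact tensorRestrictsTo_precomp _ _ _ _

/-- **`mmPair 2 ≥ ⟨2,2,2⟩`**: `⟨2,2,2⟩ (κ,ν) (κ',μ) (μ',ν') = mmPair 2 (ν,κ) (μ,κ') (σμ', ν')`.
[cite: Blaser2013, §5 (the tensor ⟨k,m,n⟩)] -/
theorem mmPair_two_restrictsTo_matMul :
    TensorRestrictsTo (mmPair 2) (matMulTensor ℂ 2 2 2) := by
  have e : matMulTensor ℂ 2 2 2 =
      fun a b c => mmPair 2 (a.2, a.1) (b.2, b.1) (flip c.1, c.2) := by
    funext a b c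
    obtain ⟨a₁, a₂⟩ := a
    obtain ⟨b₁, b₂⟩ := b
    obtain ⟨c₁, c₂⟩ := c
    simp only [mmPair, uHalf, wPlain, matMulTensor, flip, Pi.add_apply]
    fin_cases a₁ <;> fin_cases a₂ <;> fin_cases b₁ <;> fin_cases b₂ <;> fin_cases c₁ <;>
      fin_cases c₂ <;> simp
  rw [e]
  exact tensorRestrictsTo_precomp _ _ _ _

/-- **`⟨2,2,2⟩ ≥ mmPair 2`** (the same relabelling is a bijection). [cite: Blaser2013, Lemma 5.4] -/
theorem matMul_restrictsTo_mmPair_two :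
    TensorRestrictsTo (matMulTensor ℂ 2 2 2) (mmPair 2) := by
  have e : matMulTensor ℂ 2 2 2 =
      fun a b c => mmPair 2 (Equiv.prodComm (Fin 2) (Fin 2) a) (Equiv.prodComm (Fin 2) (Fin 2) b)
        (Equiv.prodCongr (Equiv.swap (0 : Fin 2) 1) (Equiv.refl (Fin 2)) c) := by
    funext a b c
    obtain ⟨a₁, a₂⟩ := a
    obtain ⟨b₁, b₂⟩ := b
    obtain ⟨c₁, c₂⟩ := c
    simp only [mmPair, uHalf, wPlain, matMulTensor, Pi.add_apply, Equiv.prodComm_apply,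
      Equiv.prodCongr_apply, Equiv.coe_refl, Prod.map_apply, Prod.swap_prod_mk, id_eq]
    fin_cases a₁ <;> fin_cases a₂ <;> fin_cases b₁ <;> fin_cases b₂ <;> fin_cases c₁ <;>
      fin_cases c₂ <;> simp [Equiv.swap_apply_left, Equiv.swap_apply_right]
  rw [e]
  exact tensorRestrictsTo_of_reindex _ _ _ _

/-! ## 4. The trace defect: `C₁ ⊕ ⟨1,2,1⟩ ≥ ⟨2,2,2⟩` and `⟨2,2,2⟩ ⊕ ⟨1,2,1⟩ ≥ C₁` -/

/-- **`C₁ ⊕ ⟨1,2,1⟩ ≥ ⟨2,2,2⟩`** — the coupled Coppersmith–Winograd block plus ONE scalar–vector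
product restricts to `2 × 2` matrix multiplication (explicit `0/±1` matrices: the adjugate identity
`A·w = −J⁻¹Aᵀ(Jw) + tr(A)·w`). [cite: ChristandlVranaZuiddam2023, §1.1] -/
theorem directSum_coupling₁_restrictsTo_matMul :
    TensorRestrictsTo (directSumTensor coupling₁ (matMulTensor ℂ 1 2 1)) (matMulTensor ℂ 2 2 2) := by
  have h₁ : TensorRestrictsTo (directSumTensor coupling₁ (matMulTensor ℂ 1 2 1))
      (directSumTensor (uHalf 2 - adjTwist) traceHelper) :=
    (coupling₁_restrictsTo_pairTensor.trans pairTensor_restrictsTo_uHalf_sub_adjTwist).directSum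
      matMul121_restrictsTo_traceHelper
  have h₂ : TensorRestrictsTo (directSumTensor (uHalf 2 - adjTwist) traceHelper) (mmPair 2) := by
    rw [mmPair_two_eq]
    exact directSumTensor_restrictsTo_add' _ _
  exact (h₁.trans h₂).trans mmPair_two_restrictsTo_matMul

/-- **`⟨2,2,2⟩ ⊕ ⟨1,2,1⟩ ≥ C₁`** — conversely, `2 × 2` matrix multiplication plus ONE scalar–vector
product restricts to the coupled block (`Aᵀ·w = −J⁻¹A(Jw) + tr(A)·w`). [cite: ChristandlVranaZuiddam2023, §1.1] -/
theorem directSum_matMul_restrictsTo_coupling₁ :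
    TensorRestrictsTo (directSumTensor (matMulTensor ℂ 2 2 2) (matMulTensor ℂ 1 2 1)) coupling₁ := by
  have h₁ : TensorRestrictsTo (directSumTensor (matMulTensor ℂ 2 2 2) (matMulTensor ℂ 1 2 1))
      (directSumTensor (uHalf 2 - adjTwist') traceHelper) :=
    (matMul_restrictsTo_mmPair_two.trans mmPair_restrictsTo_uHalf_sub_adjTwist').directSum
      matMul121_restrictsTo_traceHelper
  have h₂ : TensorRestrictsTo (directSumTensor (uHalf 2 - adjTwist') traceHelper) (pairTensor 2) := by
    rw [pairTensor_two_eq]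
    exact directSumTensor_restrictsTo_add' _ _
  exact (h₁.trans h₂).trans pairTensor_restrictsTo_coupling₁

/-! ## 5. At universal points: `|F(C₁) − F⟨2,2,2⟩| ≤ F⟨1,2,1⟩ = 2^{θ₁}` -/

variable {F : SpectralMap ℂ}

/-- `F⟨1,2,1⟩ = 2^{θ₁}`. [cite: AlmanLi2026, Prop. 4.1] -/
theorem map_matMul121_eq_rpow (hF : IsUniversalSpectralPoint ℂ F) :
    F (matMulTensor ℂ 1 2 1) = (2 : ℝ) ^ specMMPoint ℂ F 1 := by
  have h := AlmanLi2026.prop41 hF (n := 1) (m := 2) (p := 1) le_rfl (by norm_num) le_rfl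
  simpa using h

/-- `F⟨1,2,1⟩ ≤ 2` (`θ₁ ≤ 1`). [cite: AlmanLi2026, Prop. 4.2] -/
theorem map_matMul121_le_two (hF : IsUniversalSpectralPoint ℂ F) : F (matMulTensor ℂ 1 2 1) ≤ 2 := by
  rw [map_matMul121_eq_rpow hF]
  have h := (AlmanLi2026.prop42_mem_Icc hF 1).2
  calc (2 : ℝ) ^ specMMPoint ℂ F 1 ≤ (2 : ℝ) ^ (1 : ℝ) :=
        Real.rpow_le_rpow_of_exponent_le (by norm_num) h
    _ = 2 := Real.rpow_one 2

/-- **The leaf up to one letter: `F⟨2,2,2⟩ ≤ F(C₁) + F⟨1,2,1⟩`** at every universal point.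
[cite: ChristandlVranaZuiddam2023, §1.2] -/
theorem map_matMul_le_map_coupling₁_add (hF : IsUniversalSpectralPoint ℂ F) :
    F (matMulTensor ℂ 2 2 2) ≤ F coupling₁ + F (matMulTensor ℂ 1 2 1) := by
  have h := hF.mono _ _ directSum_coupling₁_restrictsTo_matMul
  rwa [hF.map_directSum] at h

/-- **Its converse up to one letter: `F(C₁) ≤ F⟨2,2,2⟩ + F⟨1,2,1⟩`** at every universal point.
[cite: ChristandlVranaZuiddam2023, §1.2] -/
theorem map_coupling₁_le_map_matMul_add (hF : IsUniversalSpectralPoint ℂ F) :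
    F coupling₁ ≤ F (matMulTensor ℂ 2 2 2) + F (matMulTensor ℂ 1 2 1) := by
  have h := hF.mono _ _ directSum_matMul_restrictsTo_coupling₁
  rwa [hF.map_directSum] at h

/-- **THE ONE-LETTER SANDWICH `|F(C₁) − F⟨2,2,2⟩| ≤ F⟨1,2,1⟩`.** [cite: ChristandlVranaZuiddam2023, §1.2] -/
theorem abs_map_coupling₁_sub_map_matMul_le (hF : IsUniversalSpectralPoint ℂ F) :
    |F coupling₁ - F (matMulTensor ℂ 2 2 2)| ≤ F (matMulTensor ℂ 1 2 1) := by
  rw [abs_sub_le_iff]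
  constructor <;> linarith [map_matMul_le_map_coupling₁_add hF, map_coupling₁_le_map_matMul_add hF]

/-- Numerically: `|F(C₁) − F⟨2,2,2⟩| ≤ 2` at every universal point. [cite: AlmanLi2026, Prop. 4.2] -/
theorem abs_map_coupling₁_sub_map_matMul_le_two (hF : IsUniversalSpectralPoint ℂ F) :
    |F coupling₁ - F (matMulTensor ℂ 2 2 2)| ≤ 2 :=
  (abs_map_coupling₁_sub_map_matMul_le hF).trans (map_matMul121_le_two hF)

/-- In letters: **`2^{θ₀+θ₁+θ₂} − 2^{θ₁} ≤ F(C₁)`**. [cite: AlmanLi2026, Prop. 4.1] -/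
theorem rpow_sum_sub_rpow_le_map_coupling₁ (hF : IsUniversalSpectralPoint ℂ F) :
    (2 : ℝ) ^ ∑ i, specMMPoint ℂ F i - (2 : ℝ) ^ specMMPoint ℂ F 1 ≤ F coupling₁ := by
  rw [← map_matMul_eq_rpow hF, ← map_matMul121_eq_rpow hF]
  linarith [map_matMul_le_map_coupling₁_add hF]

/-- In letters: **`F(C₁) ≤ 2^{θ₀+θ₁+θ₂} + 2^{θ₁}`**. [cite: AlmanLi2026, Prop. 4.1] -/
theorem map_coupling₁_le_rpow_sum_add_rpow (hF : IsUniversalSpectralPoint ℂ F) :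
    F coupling₁ ≤ (2 : ℝ) ^ ∑ i, specMMPoint ℂ F i + (2 : ℝ) ^ specMMPoint ℂ F 1 := by
  rw [← map_matMul_eq_rpow hF, ← map_matMul121_eq_rpow hF]
  exact map_coupling₁_le_map_matMul_add hF

end Summit.MatrixMultiplication.MatrixMultiplication.Theorems.OutsiderSandwichTraceDefect
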